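import Summits.Ventures.Crystal3D.Theorems.StickyWulffConstantTextureBuildSingleGrainMesh
import Summits.Ventures.Crystal3D.Theorems.StickyWulffConstantTextureBuildLocalAgreement
import Summits.Ventures.Crystal3D.Theorems.StickyWulffConstantTextureLiminfResolutionOfRigidity
import HarnessLib

/-!
# TB-cover, BASE CASE (part 3): `stub_TB_cover`'s conclusion, in its own quantifier shape, for packings on ONE Barlow stacking
# (lane T, crux `TextureLiminfV5`, stmt-Ventures-23912; registered stub `stub_TB_cover` of `TexShadow` v8.23)

HONEST FRAMING. Venture `Summits/Ventures/Crystal3D` (cell `crystal3d-full`), route `route-Ventures-StickyWulffConstant`, helper `--supports` the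
law-v5 crux `TextureLiminfV5` (stmt-Ventures-23912).  Pure proof (census-free, standard axioms) over '…TextureBuildSingleGrainMesh' (the cover and mesh),
'…TextureBuildLocalAgreement' (`mem_of_perfect_near`: perfect material is complete) and '…TextureLiminfResolutionOfRigidity' (`card_filter_dist_le`: the
packing count around one ball).

**`tb_cover_of_single_stacking`**: for all `C R₀ K δ θ` with `0 < δ`, `0 < θ` there is `N₀` such that every unit packing of `N ≥ N₀` balls with
`6N − b ≤ K·N^{2/3}` whose balls all lie on ONE moved Barlow stacking admits `(rc : RiseredCover C R₀ N x) (μ : Mesh₇ rc δ)` with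
`rc.tilingLoss₂ + rc.rimSum + μ.gapCost ≤ θ·N^{2/3} + rc.unownedSlack₃` — i.e. the conclusion of `stub_TB_cover` VERBATIM on the single-grain class (no
resolution, adhesion or saturation hypothesis needed there).  COUNTING (the constructor's MASS lemma, reusable grain by grain): the balls with `≠ 12`
contacts number `≤ Σ(12 − deg) = 2(6N − b) ≤ 2K·N^{2/3}`; a ball with no such ball within `4` has, by `mem_of_perfect_near`, all `S`-sites within `3`
occupied (`solid_of_good`: it can carry the core) and all within `2√2` occupied (`complete_of_good`: it counts for the mass); the others number
`≤ 9³·2K·N^{2/3} ≤ min(δ, ½)·N` for `N ≥ N₀`.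
WHAT THIS IS NOT: the multi-grain constructor of `stub_TB_cover` (wall cells, risers, gap pieces) — open; F-C1 not moved.
-/

noncomputable section

open scoped BigOperators InnerProductSpace
open MeasureTheory

namespace Summit.Ventures.Crystal3D.Cruxes.TextureLiminf.TexShadow

open Summit.Ventures.Crystal3D Summit.Ventures.Crystal3D.Theorems Finset
open Literature.MathematicalPhysics.StatisticalMechanics (IsHaggSeq)

section Counting

variable {N : ℕ} {x : Fin N → E3}

/-- Bridge: twelve contacts give twelve balls of the configuration's point set at distance `1`. -/
theorem twelve_le_card_filter_of_coordination (hx : IsUnitPacking x) {i : Fin N} (h : coordination x i = 12) :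
    12 ≤ ((Finset.univ.image x).filter fun y => dist (x i) y = 1).card := by
  classical
  have h12 : (contactNeighbors x i).card = 12 := h
  rw [← h12]
  have hsub : (contactNeighbors x i).image x ⊆ (Finset.univ.image x).filter fun y => dist (x i) y = 1 := by
    intro y hy
    rw [Finset.mem_image] at hy
    obtain ⟨j, hj, rfl⟩ := hy
    rw [mem_contactNeighbors] at hj
    exact Finset.mem_filter.2 ⟨Finset.mem_image_of_mem _ (Finset.mem_univ _), hj.2⟩
  calc (contactNeighbors x i).card = ((contactNeighbors x i).image x).card :=
        (Finset.card_image_of_injective _ hx.injective).symm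
    _ ≤ _ := Finset.card_le_card hsub

/-- The defective balls (`≠ 12` contacts) number at most `2·(6N − b)`. -/
theorem card_defective_le (hx : IsUnitPacking x) :
    ((univ.filter fun i => coordination x i ≠ 12).card : ℝ) ≤ 2 * (6 * (N : ℝ) - (numContacts x : ℝ)) := by
  have h1 := card_coordination_ne_twelve_le_sum hx
  have h2 := sum_twelve_sub_coordination_add hx
  set T : ℕ := ∑ i, (12 - coordination x i) with hT
  have h3 : (T : ℝ) + 2 * (numContacts x : ℝ) = 12 * (N : ℝ) := by exact_mod_cast h2
  have h1' : ((univ.filter fun i => coordination x i ≠ 12).card : ℝ) ≤ (T : ℝ) := by exact_mod_cast h1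
  linarith

variable {L : E3 ≃ₗᵢ[ℝ] E3} {s : E3} {σ : ℤ → ℤ}

/-- **A GOOD BALL IS LOCALLY COMPLETE**: if every ball lies on the stacking `S` and every ball within `R + 1` of `x i` has twelve contacts, then every
`S`-site within `R` of `x i` is a ball. -/
theorem complete_of_good (hx : IsUnitPacking x) (hσ : IsHaggSeq σ) (hS : ∀ i, x i ∈ stacking L s σ) {i : Fin N} {R : ℝ}
    (hgood : ∀ j, dist (x j) (x i) ≤ R + 1 → coordination x j = 12) :
    ∀ b ∈ stacking L s σ, dist (x i) b ≤ R → b ∈ Set.range x := by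
  classical
  set X : Finset E3 := Finset.univ.image x with hX
  have hmemX : ∀ y ∈ X, ∃ j, x j = y := fun y hy => by
    rw [hX, Finset.mem_image] at hy
    obtain ⟨j, -, hj⟩ := hy
    exact ⟨j, hj⟩
  have hp₀ : x i ∈ X := Finset.mem_image_of_mem _ (Finset.mem_univ _)
  have hXS : ∀ y ∈ X, dist y (x i) ≤ R + 2 → y ∈ stacking L s σ := by
    intro y hy _
    obtain ⟨j, rfl⟩ := hmemX y hy
    exact hS j
  have h12 : ∀ y ∈ X, dist y (x i) ≤ R + 1 → 12 ≤ (X.filter fun y' => dist y y' = 1).card := by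
    intro y hy hd
    obtain ⟨j, rfl⟩ := hmemX y hy
    exact twelve_le_card_filter_of_coordination hx (hgood j hd)
  intro b hb hdb
  have hbX := mem_of_perfect_near hσ X hp₀ (hS i) R hXS h12 b hb (by rw [dist_comm]; exact hdb)
  obtain ⟨j, rfl⟩ := hmemX b hbX
  exact ⟨j, rfl⟩

end Counting

open scoped Classical in
/-- **`stub_TB_cover`'S CONCLUSION FOR SINGLE-GRAIN PACKINGS** (any wall-law constants `C, R₀`; any `K`; `δ, θ > 0`). -/
theorem tb_cover_of_single_stacking (C R₀ K δ θ : ℝ) (hδ : 0 < δ) (hθ : 0 < θ) :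
    ∃ N₀ : ℕ, ∀ N : ℕ, N₀ ≤ N → ∀ x : Fin N → E3, IsUnitPacking x →
      6 * (N : ℝ) - (numContacts x : ℝ) ≤ K * (N : ℝ) ^ ((2 : ℝ) / 3) →
      (∃ (L : E3 ≃ₗᵢ[ℝ] E3) (s : E3) (σ : ℤ → ℤ), IsHaggSeq σ ∧ ∀ i, x i ∈ stacking L s σ) →
      ∃ (rc : RiseredCover C R₀ N x) (μ : Mesh₇ rc δ),
        rc.tilingLoss₂ + rc.rimSum + μ.gapCost ≤ θ * (N : ℝ) ^ ((2 : ℝ) / 3) + rc.unownedSlack₃ := by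
  classical
  -- constants: lost balls `≤ c₁·2K·N^{2/3}` with `c₁ = 9³`, to be `≤ δ₁ N`, `δ₁ = min δ (1/2)`
  set δ₁ : ℝ := min δ (1 / 2) with hδ₁
  have hδ₁0 : 0 < δ₁ := lt_min hδ (by norm_num)
  have hδ₁δ : δ₁ ≤ δ := min_le_left _ _
  have hδ₁h : δ₁ ≤ 1 / 2 := min_le_right _ _
  set c₁ : ℝ := (2 * 4 + 1) ^ 3 with hc₁
  have hc₁0 : 0 ≤ c₁ := by rw [hc₁]; norm_num
  set A : ℝ := max 0 (2 * K * c₁ / δ₁) with hAdef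
  have hA0 : 0 ≤ A := le_max_left _ _
  have hAK : 2 * K * c₁ ≤ δ₁ * A := by
    have : 2 * K * c₁ / δ₁ ≤ A := le_max_right _ _
    rw [div_le_iff₀ hδ₁0] at this
    linarith
  obtain ⟨N₁, hN₁⟩ := exists_nat_ge (A ^ 3)
  refine ⟨N₁ + 1, fun N hN x hx hdef hstack => ?_⟩
  obtain ⟨L, s, σ, hσ, hS⟩ := hstack
  have hN1 : (A ^ 3 : ℝ) ≤ N := hN₁.trans (by exact_mod_cast (Nat.le_succ N₁).trans hN)
  have hNpos : (1 : ℝ) ≤ N := by exact_mod_cast (show 1 ≤ N by omega)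
  -- (1) defective balls
  set B : Finset (Fin N) := univ.filter fun i => coordination x i ≠ 12 with hBdef
  have hB : (B.card : ℝ) ≤ 2 * K * (N : ℝ) ^ ((2 : ℝ) / 3) := by
    have := card_defective_le hx
    rw [← hBdef] at this
    linarith
  -- (2) lost and good balls
  set Lost : Finset (Fin N) := univ.filter fun i => ∃ j ∈ B, dist (x i) (x j) ≤ 4 with hLost
  set Good : Finset (Fin N) := univ.filter fun i => ¬ ∃ j ∈ B, dist (x i) (x j) ≤ 4 with hGood
  have hLost_le : (Lost.card : ℝ) ≤ (B.card : ℝ) * c₁ := by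
    have hsub : Lost ⊆ B.biUnion fun j => univ.filter fun i => dist (x i) (x j) ≤ 4 := by
      intro i hi
      rw [hLost, Finset.mem_filter] at hi
      obtain ⟨j, hjB, hji⟩ := hi.2
      exact Finset.mem_biUnion.2 ⟨j, hjB, Finset.mem_filter.2 ⟨Finset.mem_univ _, hji⟩⟩
    calc (Lost.card : ℝ) ≤ ((B.biUnion fun j => univ.filter fun i => dist (x i) (x j) ≤ 4).card : ℝ) := by
          exact_mod_cast Finset.card_le_card hsub
      _ ≤ ∑ j ∈ B, (((univ.filter fun i => dist (x i) (x j) ≤ 4).card : ℕ) : ℝ) := by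
          exact_mod_cast Finset.card_biUnion_le
      _ ≤ ∑ _j ∈ B, c₁ := Finset.sum_le_sum fun j _ => card_filter_dist_le hx j (by norm_num)
      _ = (B.card : ℝ) * c₁ := by rw [Finset.sum_const, nsmul_eq_mul]
  have hGood_card : (Good.card : ℝ) = (N : ℝ) - Lost.card := by
    have hsum : Lost.card + Good.card = N := by
      rw [hLost, hGood, Finset.card_filter_add_card_filter_not, Finset.card_univ, Fintype.card_fin]
    have := congrArg (fun n : ℕ => (n : ℝ)) hsum
    simp only [Nat.cast_add] at this
    linarith
  -- `Lost ≤ δ₁ N`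
  have hNnn : (0 : ℝ) ≤ N := Nat.cast_nonneg N
  have hcube : A ≤ (N : ℝ) ^ ((1 : ℝ) / 3) := by
    rw [show ((1 : ℝ) / 3) = ((3 : ℕ) : ℝ)⁻¹ by norm_num]
    calc A = (A ^ 3) ^ (((3 : ℕ) : ℝ)⁻¹) := (Real.pow_rpow_inv_natCast hA0 (by norm_num)).symm
      _ ≤ (N : ℝ) ^ (((3 : ℕ) : ℝ)⁻¹) := Real.rpow_le_rpow (by positivity) hN1 (by positivity)
  have hsplit : (N : ℝ) ^ ((2 : ℝ) / 3) * (N : ℝ) ^ ((1 : ℝ) / 3) = (N : ℝ) := by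
    rcases Nat.eq_zero_or_pos N with hz | hpos
    · subst hz; simp
    · rw [← Real.rpow_add (by exact_mod_cast hpos)]; norm_num
  have h23 : 0 ≤ (N : ℝ) ^ ((2 : ℝ) / 3) := Real.rpow_nonneg hNnn _
  have hlost : (Lost.card : ℝ) ≤ δ₁ * N := by
    calc (Lost.card : ℝ) ≤ (B.card : ℝ) * c₁ := hLost_le
      _ ≤ 2 * K * (N : ℝ) ^ ((2 : ℝ) / 3) * c₁ := mul_le_mul_of_nonneg_right hB hc₁0
      _ = (2 * K * c₁) * (N : ℝ) ^ ((2 : ℝ) / 3) := by ring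
      _ ≤ (δ₁ * A) * (N : ℝ) ^ ((2 : ℝ) / 3) := mul_le_mul_of_nonneg_right hAK h23
      _ ≤ (δ₁ * (N : ℝ) ^ ((1 : ℝ) / 3)) * (N : ℝ) ^ ((2 : ℝ) / 3) :=
          mul_le_mul_of_nonneg_right (mul_le_mul_of_nonneg_left hcube hδ₁0.le) h23
      _ = δ₁ * ((N : ℝ) ^ ((2 : ℝ) / 3) * (N : ℝ) ^ ((1 : ℝ) / 3)) := by ring
      _ = δ₁ * N := by rw [hsplit]
  -- (3) good balls are complete within `3` and within `2√2`
  have hgood : ∀ i ∈ Good, ∀ j, dist (x j) (x i) ≤ 4 → coordination x j = 12 := by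
    intro i hi j hj
    rw [hGood, Finset.mem_filter] at hi
    by_contra hne
    exact hi.2 ⟨j, Finset.mem_filter.2 ⟨Finset.mem_univ _, hne⟩, by rw [dist_comm]; exact hj⟩
  have hsolid : ∀ i ∈ Good, ∀ b ∈ stacking L s σ, dist (x i) b < 3 → b ∈ Set.range x := fun i hi b hb hd =>
    complete_of_good hx hσ hS (R := 3) (fun j hj => hgood i hi j (by linarith)) b hb hd.le
  have h2 : Real.sqrt 2 < 3 / 2 := by
    rw [show (3 / 2 : ℝ) = Real.sqrt ((3 / 2) ^ 2) by rw [Real.sqrt_sq (by norm_num)]]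
    exact Real.sqrt_lt_sqrt (by norm_num) (by norm_num)
  have hcomplete : ∀ i ∈ Good, ∀ b ∈ stacking L s σ, dist (x i) b ≤ 2 * Real.sqrt 2 → b ∈ Set.range x := fun i hi b hb hd =>
    complete_of_good hx hσ hS (R := 2 * Real.sqrt 2)
      (fun j hj => hgood i hi j (by linarith)) b hb hd
  -- (4) a good ball exists (the core)
  have hGood_pos : 0 < Good.card := by
    have h1 : (Lost.card : ℝ) ≤ (1 / 2) * N := hlost.trans (mul_le_mul_of_nonneg_right hδ₁h hNnn)
    have h2 : (0 : ℝ) < Good.card := by rw [hGood_card]; linarith [hNpos]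
    exact_mod_cast h2
  obtain ⟨i₀, hi₀⟩ := Finset.card_pos.1 hGood_pos
  -- (5) the mass count
  have hmass : (1 - δ) * (N : ℝ) ≤
      ((Finset.univ.filter fun i : Fin N => ∀ b ∈ stacking L s σ, dist (x i) b ≤ 2 * Real.sqrt 2 → b ∈ Set.range x).card : ℝ) := by
    have hsub : Good ⊆ Finset.univ.filter fun i : Fin N => ∀ b ∈ stacking L s σ, dist (x i) b ≤ 2 * Real.sqrt 2 → b ∈ Set.range x :=
      fun i hi => Finset.mem_filter.2 ⟨Finset.mem_univ _, hcomplete i hi⟩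
    have h1 : (Good.card : ℝ) ≤
        ((Finset.univ.filter fun i : Fin N => ∀ b ∈ stacking L s σ, dist (x i) b ≤ 2 * Real.sqrt 2 → b ∈ Set.range x).card : ℝ) := by
      exact_mod_cast Finset.card_le_card hsub
    have h2 : (1 - δ) * (N : ℝ) ≤ Good.card := by
      rw [hGood_card]
      have : δ₁ * (N : ℝ) ≤ δ * N := mul_le_mul_of_nonneg_right hδ₁δ hNnn
      linarith
    exact h2.trans h1
  exact exists_singleGrain_cover_mesh_slack C R₀ δ hx hσ hS i₀ (hsolid i₀ hi₀) hmass hθ.le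

end Summit.Ventures.Crystal3D.Cruxes.TextureLiminf.TexShadow

end
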